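import Summits.CriticalPhenomena.PercolationContinuityZ3.Theorems.PercNearOneGluingNoHeavyLowerTailApexTwoSumCells
import HarnessLib

/-!
# `NoHeavyLowerTail` (stmt-CriticalPhenomena-4575) — 2-sums through the apex, part 3:
# pointwise weight identities for the four R1 cells of a configuration glued along `{a, h}`

Support file (prover prim-gen-kcluster gen 72; `--supports stmt-CriticalPhenomena-4575`).  No definitions, no
named facts, no sorries.

SETTING as in parts 1–2: apex `a`, hub `h`, arms `DX ∋ b`, `DY ∋ c` meeting only in `{a, h}`, `b` private to `DX`,
`c` private to `DY`; parameters `w` vanishing off `DX ∪ DY`; blocks `ζ_X = ω ∩ DX`, `ζ_Y = ω ∖ DX`; `T = {a, h}`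
WIRED counts `k^T`.  With the arm-cell functions `F_σ(ζ) = 1_σ(ζ) q^{k^T(ζ)}` (`σ ∈ {A, B, C, D, E, N}`, part 2) the
free random-cluster weight `w_φ(ω) = weight(ω) q^{k(ω)}` restricted to each cell of the glued instance `(a; b, c)`,
times `q^{k^T(∅)}`, is `weight(ω)` times a bilinear form in the arm-cell functions of the two blocks:
* `ApexTwoSum.pt_T`:  `F_A^X (F_A^Y + F_C^Y + F_D^Y) + F_C^X F_A^Y + q F_C^X F_C^Y + F_D^X F_A^Y`;
* `ApexTwoSum.pt_Ub`: `F_A^X (F_B^Y + F_E^Y) + F_C^X F_B^Y + q F_C^X (F_D^Y + F_E^Y) + F_D^X F_B^Y`;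
* `ApexTwoSum.pt_Uc`: the mirror image;
* `ApexTwoSum.pt_S`:  `F_B^X F_B^Y + F_B^X F_E^Y + F_E^X F_B^Y + q (F_N^X (F_D^Y + F_E^Y) + (F_D^X + F_E^X) F_N^Y − F_N^X F_N^Y)`
(free count = wired count `+ [h ∉ C(a)]`, `ApexTwoSum.k_of_mem / k_of_not_mem`; wired additivity `ApexTwoSum.kT_add`;
join rules `ApexTwoSum.glued_*_iff`; separation `ApexTwoSum.glued_sep_iff / sep_two_of_mem`; tables of part 2).
-/

noncomputable section

namespace Summit.CriticalPhenomena.PercolationContinuityZ3.Theorems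

namespace ApexTwoSum

open Finset SimpleGraph Literature.Probability.Percolation Literature.Probability.Percolation.Gladkov
open Literature.Probability.Percolation.BHK2006 (weight)
open Literature.Probability.Percolation.DecisionTree (ind ind_of_mem ind_of_not_mem)
open Literature.Probability.LatticeModels RefinedRowR3 ThreePointLB
open scoped Classical

variable {V : Type*} [Fintype V]

/-! ### Small facts -/

/-- A configuration containing a pair off the support has product weight zero. [folklore] -/
theorem weight_eq_zero_of_mem_not_mem (u : Sym2 V → unitInterval) {D : Set (Sym2 V)}
    (hu : ∀ e ∉ D, (u e : ℝ) = 0) {ω : BondConfig V} {e : Sym2 V} (heω : e ∈ ω) (heD : e ∉ D) :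
    weight (fun e => (u e : ℝ)) ω = 0 := by
  unfold weight
  exact Finset.prod_eq_zero (Finset.mem_univ e) (by simp only [if_pos heω]; exact hu e heD)

/-- Transitivity in an arm (event form): `t ~ a` and `h ~ a` give `h ~ t`. [folklore] -/
theorem arm_t1 {a h t : V} (η : BondConfig V) (h1 : η ∈ {η : BondConfig V | t ∈ cl η.toFinset a})
    (h2 : η ∈ {η : BondConfig V | h ∈ cl η.toFinset a}) : η ∈ {η : BondConfig V | h ∈ cl η.toFinset t} := by
  simp only [Set.mem_setOf_eq] at h1 h2 ⊢; exact mem_cl_trans (mem_cl_comm.1 h1) h2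

/-- Transitivity in an arm (event form): `t ~ a` and `h ~ t` give `h ~ a`. [folklore] -/
theorem arm_t2 {a h t : V} (η : BondConfig V) (h1 : η ∈ {η : BondConfig V | t ∈ cl η.toFinset a})
    (h2 : η ∈ {η : BondConfig V | h ∈ cl η.toFinset t}) : η ∈ {η : BondConfig V | h ∈ cl η.toFinset a} := by
  simp only [Set.mem_setOf_eq] at h1 h2 ⊢; exact mem_cl_trans h1 h2

/-- Transitivity in an arm (event form): `h ~ a` and `h ~ t` give `t ~ a`. [folklore] -/
theorem arm_t3 {a h t : V} (η : BondConfig V) (h1 : η ∈ {η : BondConfig V | h ∈ cl η.toFinset a})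
    (h2 : η ∈ {η : BondConfig V | h ∈ cl η.toFinset t}) : η ∈ {η : BondConfig V | t ∈ cl η.toFinset a} := by
  simp only [Set.mem_setOf_eq] at h1 h2 ⊢; exact mem_cl_trans h1 (mem_cl_comm.1 h2)

section Pointwise

variable {DX DY : Finset (Sym2 V)} {a h b c : V} (hah : a ≠ h) (hab : a ≠ b) (hac : a ≠ c) (hbc : b ≠ c)
  (hhb : h ≠ b) (hhc : h ≠ c)
  (hsepD : ∀ v : V, (∃ e ∈ DX, v ∈ e) → (∃ e ∈ DY, v ∈ e) → (v = a ∨ v = h))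
  (hbY : ∀ e ∈ DY, b ∉ e) (hcX : ∀ e ∈ DX, c ∉ e)
  (w : Sym2 V → unitInterval) (q : ℝ) (hw : ∀ e, e ∉ (↑DX ∪ ↑DY : Set (Sym2 V)) → (w e : ℝ) = 0)
include hah hab hac hsepD hbY hcX hw

/-- **Pointwise decomposition, cell `T = {b, c ∈ C(a)}`** (see the module docstring). [this work] -/
theorem pt_T (ω : BondConfig V) :
    rcWeightW w q ∅ ω * ind {η : BondConfig V | b ∈ cl η.toFinset a ∧ c ∈ cl η.toFinset a} ω * q ^ clusterCount (∅ : BondConfig V) ({a, h} : Set V) =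
      weight (fun e => (w e : ℝ)) ω * ((ind {η : BondConfig V | b ∈ cl η.toFinset a ∧ h ∈ cl η.toFinset a} (ω ∩ ↑DX) * q ^ clusterCount (ω ∩ ↑DX) ({a, h} : Set V)) * ((ind {η : BondConfig V | c ∈ cl η.toFinset a ∧ h ∈ cl η.toFinset a} (ω \ ↑DX) * q ^ clusterCount (ω \ ↑DX) ({a, h} : Set V)) + (ind {η : BondConfig V | c ∈ cl η.toFinset a ∧ h ∉ cl η.toFinset a} (ω \ ↑DX) * q ^ clusterCount (ω \ ↑DX) ({a, h} : Set V)) + (ind {η : BondConfig V | c ∉ cl η.toFinset a ∧ h ∉ cl η.toFinset a ∧ h ∈ cl η.toFinset c} (ω \ ↑DX) * q ^ clusterCount (ω \ ↑DX) ({a, h} : Set V))) + (ind {η : BondConfig V | b ∈ cl η.toFinset a ∧ h ∉ cl η.toFinset a} (ω ∩ ↑DX) * q ^ clusterCount (ω ∩ ↑DX) ({a, h} : Set V)) * (ind {η : BondConfig V | c ∈ cl η.toFinset a ∧ h ∈ cl η.toFinset a} (ω \ ↑DX) * q ^ clusterCount (ω \ ↑DX) ({a, h} : Set V)) + q * (ind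 {η : BondConfig V | b ∈ cl η.toFinset a ∧ h ∉ cl η.toFinset a} (ω ∩ ↑DX) * q ^ clusterCount (ω ∩ ↑DX) ({a, h} : Set V)) * (ind {η : BondConfig V | c ∈ cl η.toFinset a ∧ h ∉ cl η.toFinset a} (ω \ ↑DX) * q ^ clusterCount (ω \ ↑DX) ({a, h} : Set V)) + (ind {η : BondConfig V | b ∉ cl η.toFinset a ∧ h ∉ cl η.toFinset a ∧ h ∈ cl η.toFinset b} (ω ∩ ↑DX) * q ^ clusterCount (ω ∩ ↑DX) ({a, h} : Set V)) * (ind {η : BondConfig V | c ∈ cl η.toFinset a ∧ h ∈ cl η.toFinset a} (ω \ ↑DX) * q ^ clusterCount (ω \ ↑DX) ({a, h} : Set V))) := by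
  by_cases hω : ω ⊆ ↑DX ∪ ↑DY
  swap
  · obtain ⟨e, heω, heD⟩ := Set.not_subset.1 hω
    have h0 := weight_eq_zero_of_mem_not_mem w hw heω heD
    unfold rcWeightW
    rw [h0]; ring
  have jb := glued_b_iff hab hsepD hbY hω
  have jc := glued_c_iff hac hsepD hcX hω
  have jh := glued_h_iff hsepD hω
  have hadd := kT_add hsepD hω
  -- the table identity, with the power `r = q^{[h ∉ C(a)]}`
  have htab : ∀ r : ℝ, (((ω ∩ ↑DX) ∈ {η : BondConfig V | h ∈ cl η.toFinset a} ∨ (ω \ ↑DX) ∈ {η : BondConfig V | h ∈ cl η.toFinset a}) → r = 1) → (¬ ((ω ∩ ↑DX) ∈ {η : BondConfig V | h ∈ cl η.toFinset a} ∨ (ω \ ↑DX) ∈ {η : BondConfig V | h ∈ cl η.toFinset a}) → r = q) →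
      ind {η : BondConfig V | b ∈ cl η.toFinset a ∧ c ∈ cl η.toFinset a} ω * r = (ind {η : BondConfig V | b ∈ cl η.toFinset a ∧ h ∈ cl η.toFinset a} (ω ∩ ↑DX)) * ((ind {η : BondConfig V | c ∈ cl η.toFinset a ∧ h ∈ cl η.toFinset a} (ω \ ↑DX)) + (ind {η : BondConfig V | c ∈ cl η.toFinset a ∧ h ∉ cl η.toFinset a} (ω \ ↑DX)) + (ind {η : BondConfig V | c ∉ cl η.toFinset a ∧ h ∉ cl η.toFinset a ∧ h ∈ cl η.toFinset c} (ω \ ↑DX))) + (ind {η : BondConfig V | b ∈ cl η.toFinset a ∧ h ∉ cl η.toFinset a} (ω ∩ ↑DX)) * (ind {η : BondConfig V | c ∈ cl η.toFinset a ∧ h ∈ cl η.toFinset a} (ω \ ↑DX)) + q * (ind {η : BondConfig V | b ∈ cl η.toFinset a ∧ h ∉ cl η.toFinset a} (ω ∩ ↑DX)) * (ind {η : BondConfig V | c ∈ cl η.toFinset a ∧ h ∉ cl η.toFinset a} (ω \ ↑DX)) + (ind {η : BondConfig V | b ∉ cl η.toFinset a ∧ h ∉ cl η.toFinset a ∧ h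 ∈ cl η.toFinset b} (ω ∩ ↑DX)) * (ind {η : BondConfig V | c ∈ cl η.toFinset a ∧ h ∈ cl η.toFinset a} (ω \ ↑DX)) := by
    intro r hr1 hrq
    exact table_T (arm_t1 (a := a) (h := h) (t := b) (ω ∩ ↑DX)) (arm_t2 (a := a) (h := h) (t := b) (ω ∩ ↑DX))
      (arm_t3 (a := a) (h := h) (t := b) (ω ∩ ↑DX)) (arm_t1 (a := a) (h := h) (t := c) (ω \ ↑DX))
      (arm_t2 (a := a) (h := h) (t := c) (ω \ ↑DX)) (arm_t3 (a := a) (h := h) (t := c) (ω \ ↑DX)) hr1 hrq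
      (fun hf => ind_of_mem (show ω ∈ {η : BondConfig V | b ∈ cl η.toFinset a ∧ c ∈ cl η.toFinset a} from ⟨jb.2 hf.1, jc.2 hf.2⟩)) (fun hf => ind_of_not_mem (show ω ∉ {η : BondConfig V | b ∈ cl η.toFinset a ∧ c ∈ cl η.toFinset a} from fun hT => hf ⟨jb.1 hT.1, jc.1 hT.2⟩))
      (fun hh => ind_of_mem hh) (fun hh => ind_of_not_mem hh)
      (fun hh => ind_of_mem hh) (fun hh => ind_of_not_mem hh)
      (fun hh => ind_of_mem hh) (fun hh => ind_of_not_mem hh)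
      (fun hh => ind_of_mem hh) (fun hh => ind_of_not_mem hh)
      (fun hh => ind_of_mem hh) (fun hh => ind_of_not_mem hh)
      (fun hh => ind_of_mem hh) (fun hh => ind_of_not_mem hh)
  by_cases hG : h ∈ cl ω.toFinset a
  · have hk := k_of_mem hah ω hG
    have hpow : q ^ clusterCount ω ∅ * q ^ clusterCount (∅ : BondConfig V) ({a, h} : Set V) = q ^ clusterCount (ω ∩ ↑DX) ({a, h} : Set V) * q ^ clusterCount (ω \ ↑DX) ({a, h} : Set V) := by
      rw [← pow_add, hk, hadd, pow_add]
    have ht := htab 1 (fun _ => rfl) (fun hn => absurd (jh.1 hG) hn)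
    unfold rcWeightW
    linear_combination (weight (fun e => (w e : ℝ)) ω * ind {η : BondConfig V | b ∈ cl η.toFinset a ∧ c ∈ cl η.toFinset a} ω) * hpow + (weight (fun e => (w e : ℝ)) ω * q ^ clusterCount (ω ∩ ↑DX) ({a, h} : Set V) * q ^ clusterCount (ω \ ↑DX) ({a, h} : Set V)) * ht
  · have hk := k_of_not_mem hah ω hG
    have hpow : q ^ clusterCount ω ∅ * q ^ clusterCount (∅ : BondConfig V) ({a, h} : Set V) = q * (q ^ clusterCount (ω ∩ ↑DX) ({a, h} : Set V) * q ^ clusterCount (ω \ ↑DX) ({a, h} : Set V)) := by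
      rw [← pow_add, hk, Nat.add_right_comm, hadd, pow_succ, pow_add]; ring
    have ht := htab q (fun hb => absurd (jh.2 hb) hG) (fun _ => rfl)
    unfold rcWeightW
    linear_combination (weight (fun e => (w e : ℝ)) ω * ind {η : BondConfig V | b ∈ cl η.toFinset a ∧ c ∈ cl η.toFinset a} ω) * hpow + (weight (fun e => (w e : ℝ)) ω * q ^ clusterCount (ω ∩ ↑DX) ({a, h} : Set V) * q ^ clusterCount (ω \ ↑DX) ({a, h} : Set V)) * ht

/-- **Pointwise decomposition, cell `U_b = {b ∈ C(a), c ∉ C(a)}`**. [this work] -/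
theorem pt_Ub (ω : BondConfig V) :
    rcWeightW w q ∅ ω * ind {η : BondConfig V | b ∈ cl η.toFinset a ∧ c ∉ cl η.toFinset a} ω * q ^ clusterCount (∅ : BondConfig V) ({a, h} : Set V) =
      weight (fun e => (w e : ℝ)) ω * ((ind {η : BondConfig V | b ∈ cl η.toFinset a ∧ h ∈ cl η.toFinset a} (ω ∩ ↑DX) * q ^ clusterCount (ω ∩ ↑DX) ({a, h} : Set V)) * ((ind {η : BondConfig V | c ∉ cl η.toFinset a ∧ h ∈ cl η.toFinset a} (ω \ ↑DX) * q ^ clusterCount (ω \ ↑DX) ({a, h} : Set V)) + (ind {η : BondConfig V | c ∉ cl η.toFinset a ∧ h ∉ cl η.toFinset a ∧ h ∉ cl η.toFinset c} (ω \ ↑DX) * q ^ clusterCount (ω \ ↑DX) ({a, h} : Set V))) + (ind {η : BondConfig V | b ∈ cl η.toFinset a ∧ h ∉ cl η.toFinset a} (ω ∩ ↑DX) * q ^ clusterCount (ω ∩ ↑DX) ({a, h} : Set V)) * (ind {η : BondConfig V | c ∉ cl η.toFinset a ∧ h ∈ cl η.toFinset a} (ω \ ↑DX) * q ^ clusterCount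 (ω \ ↑DX) ({a, h} : Set V)) + q * (ind {η : BondConfig V | b ∈ cl η.toFinset a ∧ h ∉ cl η.toFinset a} (ω ∩ ↑DX) * q ^ clusterCount (ω ∩ ↑DX) ({a, h} : Set V)) * ((ind {η : BondConfig V | c ∉ cl η.toFinset a ∧ h ∉ cl η.toFinset a ∧ h ∈ cl η.toFinset c} (ω \ ↑DX) * q ^ clusterCount (ω \ ↑DX) ({a, h} : Set V)) + (ind {η : BondConfig V | c ∉ cl η.toFinset a ∧ h ∉ cl η.toFinset a ∧ h ∉ cl η.toFinset c} (ω \ ↑DX) * q ^ clusterCount (ω \ ↑DX) ({a, h} : Set V))) + (ind {η : BondConfig V | b ∉ cl η.toFinset a ∧ h ∉ cl η.toFinset a ∧ h ∈ cl η.toFinset b} (ω ∩ ↑DX) * q ^ clusterCount (ω ∩ ↑DX) ({a, h} : Set V)) * (ind {η : BondConfig V | c ∉ cl η.toFinset a ∧ h ∈ cl η.toFinset a} (ω \ ↑DX) * q ^ clusterCount (ω \ ↑DX) ({a, h} : Set V))) := by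
  by_cases hω : ω ⊆ ↑DX ∪ ↑DY
  swap
  · obtain ⟨e, heω, heD⟩ := Set.not_subset.1 hω
    have h0 := weight_eq_zero_of_mem_not_mem w hw heω heD
    unfold rcWeightW
    rw [h0]; ring
  have jb := glued_b_iff hab hsepD hbY hω
  have jc := glued_c_iff hac hsepD hcX hω
  have jh := glued_h_iff hsepD hω
  have hadd := kT_add hsepD hω
  -- the table identity, with the power `r = q^{[h ∉ C(a)]}`
  have htab : ∀ r : ℝ, (((ω ∩ ↑DX) ∈ {η : BondConfig V | h ∈ cl η.toFinset a} ∨ (ω \ ↑DX) ∈ {η : BondConfig V | h ∈ cl η.toFinset a}) → r = 1) → (¬ ((ω ∩ ↑DX) ∈ {η : BondConfig V | h ∈ cl η.toFinset a} ∨ (ω \ ↑DX) ∈ {η : BondConfig V | h ∈ cl η.toFinset a}) → r = q) →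
      ind {η : BondConfig V | b ∈ cl η.toFinset a ∧ c ∉ cl η.toFinset a} ω * r = (ind {η : BondConfig V | b ∈ cl η.toFinset a ∧ h ∈ cl η.toFinset a} (ω ∩ ↑DX)) * ((ind {η : BondConfig V | c ∉ cl η.toFinset a ∧ h ∈ cl η.toFinset a} (ω \ ↑DX)) + (ind {η : BondConfig V | c ∉ cl η.toFinset a ∧ h ∉ cl η.toFinset a ∧ h ∉ cl η.toFinset c} (ω \ ↑DX))) + (ind {η : BondConfig V | b ∈ cl η.toFinset a ∧ h ∉ cl η.toFinset a} (ω ∩ ↑DX)) * (ind {η : BondConfig V | c ∉ cl η.toFinset a ∧ h ∈ cl η.toFinset a} (ω \ ↑DX)) + q * (ind {η : BondConfig V | b ∈ cl η.toFinset a ∧ h ∉ cl η.toFinset a} (ω ∩ ↑DX)) * ((ind {η : BondConfig V | c ∉ cl η.toFinset a ∧ h ∉ cl η.toFinset a ∧ h ∈ cl η.toFinset c} (ω \ ↑DX)) + (ind {η : BondConfig V | c ∉ cl η.toFinset a ∧ h ∉ cl η.toFinset a ∧ h ∉ cl η.toFinset c} (ω \ ↑DX))) + (ind {η : BondConfig V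 | b ∉ cl η.toFinset a ∧ h ∉ cl η.toFinset a ∧ h ∈ cl η.toFinset b} (ω ∩ ↑DX)) * (ind {η : BondConfig V | c ∉ cl η.toFinset a ∧ h ∈ cl η.toFinset a} (ω \ ↑DX)) := by
    intro r hr1 hrq
    exact table_Ub (arm_t1 (a := a) (h := h) (t := b) (ω ∩ ↑DX)) (arm_t2 (a := a) (h := h) (t := b) (ω ∩ ↑DX))
      (arm_t3 (a := a) (h := h) (t := b) (ω ∩ ↑DX)) (arm_t1 (a := a) (h := h) (t := c) (ω \ ↑DX))
      (arm_t2 (a := a) (h := h) (t := c) (ω \ ↑DX)) (arm_t3 (a := a) (h := h) (t := c) (ω \ ↑DX)) hr1 hrq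
      (fun hf => ind_of_mem (show ω ∈ {η : BondConfig V | b ∈ cl η.toFinset a ∧ c ∉ cl η.toFinset a} from ⟨jb.2 hf.1, fun hc' => hf.2 (jc.1 hc')⟩)) (fun hf => ind_of_not_mem (show ω ∉ {η : BondConfig V | b ∈ cl η.toFinset a ∧ c ∉ cl η.toFinset a} from fun hU => hf ⟨jb.1 hU.1, fun hc' => hU.2 (jc.2 hc')⟩))
      (fun hh => ind_of_mem hh) (fun hh => ind_of_not_mem hh)
      (fun hh => ind_of_mem hh) (fun hh => ind_of_not_mem hh)
      (fun hh => ind_of_mem hh) (fun hh => ind_of_not_mem hh)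
      (fun hh => ind_of_mem hh) (fun hh => ind_of_not_mem hh)
      (fun hh => ind_of_mem hh) (fun hh => ind_of_not_mem hh)
      (fun hh => ind_of_mem hh) (fun hh => ind_of_not_mem hh)
  by_cases hG : h ∈ cl ω.toFinset a
  · have hk := k_of_mem hah ω hG
    have hpow : q ^ clusterCount ω ∅ * q ^ clusterCount (∅ : BondConfig V) ({a, h} : Set V) = q ^ clusterCount (ω ∩ ↑DX) ({a, h} : Set V) * q ^ clusterCount (ω \ ↑DX) ({a, h} : Set V) := by
      rw [← pow_add, hk, hadd, pow_add]
    have ht := htab 1 (fun _ => rfl) (fun hn => absurd (jh.1 hG) hn)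
    unfold rcWeightW
    linear_combination (weight (fun e => (w e : ℝ)) ω * ind {η : BondConfig V | b ∈ cl η.toFinset a ∧ c ∉ cl η.toFinset a} ω) * hpow + (weight (fun e => (w e : ℝ)) ω * q ^ clusterCount (ω ∩ ↑DX) ({a, h} : Set V) * q ^ clusterCount (ω \ ↑DX) ({a, h} : Set V)) * ht
  · have hk := k_of_not_mem hah ω hG
    have hpow : q ^ clusterCount ω ∅ * q ^ clusterCount (∅ : BondConfig V) ({a, h} : Set V) = q * (q ^ clusterCount (ω ∩ ↑DX) ({a, h} : Set V) * q ^ clusterCount (ω \ ↑DX) ({a, h} : Set V)) := by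
      rw [← pow_add, hk, Nat.add_right_comm, hadd, pow_succ, pow_add]; ring
    have ht := htab q (fun hb => absurd (jh.2 hb) hG) (fun _ => rfl)
    unfold rcWeightW
    linear_combination (weight (fun e => (w e : ℝ)) ω * ind {η : BondConfig V | b ∈ cl η.toFinset a ∧ c ∉ cl η.toFinset a} ω) * hpow + (weight (fun e => (w e : ℝ)) ω * q ^ clusterCount (ω ∩ ↑DX) ({a, h} : Set V) * q ^ clusterCount (ω \ ↑DX) ({a, h} : Set V)) * ht

/-- **Pointwise decomposition, cell `U_c = {b ∉ C(a), c ∈ C(a)}`**. [this work] -/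
theorem pt_Uc (ω : BondConfig V) :
    rcWeightW w q ∅ ω * ind {η : BondConfig V | b ∉ cl η.toFinset a ∧ c ∈ cl η.toFinset a} ω * q ^ clusterCount (∅ : BondConfig V) ({a, h} : Set V) =
      weight (fun e => (w e : ℝ)) ω * ((ind {η : BondConfig V | c ∈ cl η.toFinset a ∧ h ∈ cl η.toFinset a} (ω \ ↑DX) * q ^ clusterCount (ω \ ↑DX) ({a, h} : Set V)) * ((ind {η : BondConfig V | b ∉ cl η.toFinset a ∧ h ∈ cl η.toFinset a} (ω ∩ ↑DX) * q ^ clusterCount (ω ∩ ↑DX) ({a, h} : Set V)) + (ind {η : BondConfig V | b ∉ cl η.toFinset a ∧ h ∉ cl η.toFinset a ∧ h ∉ cl η.toFinset b} (ω ∩ ↑DX) * q ^ clusterCount (ω ∩ ↑DX) ({a, h} : Set V))) + (ind {η : BondConfig V | c ∈ cl η.toFinset a ∧ h ∉ cl η.toFinset a} (ω \ ↑DX) * q ^ clusterCount (ω \ ↑DX) ({a, h} : Set V)) * (ind {η : BondConfig V | b ∉ cl η.toFinset a ∧ h ∈ cl η.toFinset a} (ω ∩ ↑DX) * q ^ clusterCount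 (ω ∩ ↑DX) ({a, h} : Set V)) + q * (ind {η : BondConfig V | c ∈ cl η.toFinset a ∧ h ∉ cl η.toFinset a} (ω \ ↑DX) * q ^ clusterCount (ω \ ↑DX) ({a, h} : Set V)) * ((ind {η : BondConfig V | b ∉ cl η.toFinset a ∧ h ∉ cl η.toFinset a ∧ h ∈ cl η.toFinset b} (ω ∩ ↑DX) * q ^ clusterCount (ω ∩ ↑DX) ({a, h} : Set V)) + (ind {η : BondConfig V | b ∉ cl η.toFinset a ∧ h ∉ cl η.toFinset a ∧ h ∉ cl η.toFinset b} (ω ∩ ↑DX) * q ^ clusterCount (ω ∩ ↑DX) ({a, h} : Set V))) + (ind {η : BondConfig V | c ∉ cl η.toFinset a ∧ h ∉ cl η.toFinset a ∧ h ∈ cl η.toFinset c} (ω \ ↑DX) * q ^ clusterCount (ω \ ↑DX) ({a, h} : Set V)) * (ind {η : BondConfig V | b ∉ cl η.toFinset a ∧ h ∈ cl η.toFinset a} (ω ∩ ↑DX) * q ^ clusterCount (ω ∩ ↑DX) ({a, h} : Set V))) := by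
  by_cases hω : ω ⊆ ↑DX ∪ ↑DY
  swap
  · obtain ⟨e, heω, heD⟩ := Set.not_subset.1 hω
    have h0 := weight_eq_zero_of_mem_not_mem w hw heω heD
    unfold rcWeightW
    rw [h0]; ring
  have jb := glued_b_iff hab hsepD hbY hω
  have jc := glued_c_iff hac hsepD hcX hω
  have jh := glued_h_iff hsepD hω
  have hadd := kT_add hsepD hω
  -- the table identity, with the power `r = q^{[h ∉ C(a)]}`
  have htab : ∀ r : ℝ, (((ω ∩ ↑DX) ∈ {η : BondConfig V | h ∈ cl η.toFinset a} ∨ (ω \ ↑DX) ∈ {η : BondConfig V | h ∈ cl η.toFinset a}) → r = 1) → (¬ ((ω ∩ ↑DX) ∈ {η : BondConfig V | h ∈ cl η.toFinset a} ∨ (ω \ ↑DX) ∈ {η : BondConfig V | h ∈ cl η.toFinset a}) → r = q) →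
      ind {η : BondConfig V | b ∉ cl η.toFinset a ∧ c ∈ cl η.toFinset a} ω * r = (ind {η : BondConfig V | c ∈ cl η.toFinset a ∧ h ∈ cl η.toFinset a} (ω \ ↑DX)) * ((ind {η : BondConfig V | b ∉ cl η.toFinset a ∧ h ∈ cl η.toFinset a} (ω ∩ ↑DX)) + (ind {η : BondConfig V | b ∉ cl η.toFinset a ∧ h ∉ cl η.toFinset a ∧ h ∉ cl η.toFinset b} (ω ∩ ↑DX))) + (ind {η : BondConfig V | c ∈ cl η.toFinset a ∧ h ∉ cl η.toFinset a} (ω \ ↑DX)) * (ind {η : BondConfig V | b ∉ cl η.toFinset a ∧ h ∈ cl η.toFinset a} (ω ∩ ↑DX)) + q * (ind {η : BondConfig V | c ∈ cl η.toFinset a ∧ h ∉ cl η.toFinset a} (ω \ ↑DX)) * ((ind {η : BondConfig V | b ∉ cl η.toFinset a ∧ h ∉ cl η.toFinset a ∧ h ∈ cl η.toFinset b} (ω ∩ ↑DX)) + (ind {η : BondConfig V | b ∉ cl η.toFinset a ∧ h ∉ cl η.toFinset a ∧ h ∉ cl η.toFinset b} (ω ∩ ↑DX))) + (ind {η : BondConfig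 V | c ∉ cl η.toFinset a ∧ h ∉ cl η.toFinset a ∧ h ∈ cl η.toFinset c} (ω \ ↑DX)) * (ind {η : BondConfig V | b ∉ cl η.toFinset a ∧ h ∈ cl η.toFinset a} (ω ∩ ↑DX)) := by
    intro r hr1 hrq
    exact table_Uc (arm_t1 (a := a) (h := h) (t := b) (ω ∩ ↑DX)) (arm_t2 (a := a) (h := h) (t := b) (ω ∩ ↑DX))
      (arm_t3 (a := a) (h := h) (t := b) (ω ∩ ↑DX)) (arm_t1 (a := a) (h := h) (t := c) (ω \ ↑DX))
      (arm_t2 (a := a) (h := h) (t := c) (ω \ ↑DX)) (arm_t3 (a := a) (h := h) (t := c) (ω \ ↑DX)) hr1 hrq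
      (fun hf => ind_of_mem (show ω ∈ {η : BondConfig V | b ∉ cl η.toFinset a ∧ c ∈ cl η.toFinset a} from ⟨fun hb' => hf.1 (jb.1 hb'), jc.2 hf.2⟩)) (fun hf => ind_of_not_mem (show ω ∉ {η : BondConfig V | b ∉ cl η.toFinset a ∧ c ∈ cl η.toFinset a} from fun hU => hf ⟨fun hb' => hU.1 (jb.2 hb'), jc.1 hU.2⟩))
      (fun hh => ind_of_mem hh) (fun hh => ind_of_not_mem hh)
      (fun hh => ind_of_mem hh) (fun hh => ind_of_not_mem hh)
      (fun hh => ind_of_mem hh) (fun hh => ind_of_not_mem hh)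
      (fun hh => ind_of_mem hh) (fun hh => ind_of_not_mem hh)
      (fun hh => ind_of_mem hh) (fun hh => ind_of_not_mem hh)
      (fun hh => ind_of_mem hh) (fun hh => ind_of_not_mem hh)
  by_cases hG : h ∈ cl ω.toFinset a
  · have hk := k_of_mem hah ω hG
    have hpow : q ^ clusterCount ω ∅ * q ^ clusterCount (∅ : BondConfig V) ({a, h} : Set V) = q ^ clusterCount (ω ∩ ↑DX) ({a, h} : Set V) * q ^ clusterCount (ω \ ↑DX) ({a, h} : Set V) := by
      rw [← pow_add, hk, hadd, pow_add]
    have ht := htab 1 (fun _ => rfl) (fun hn => absurd (jh.1 hG) hn)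
    unfold rcWeightW
    linear_combination (weight (fun e => (w e : ℝ)) ω * ind {η : BondConfig V | b ∉ cl η.toFinset a ∧ c ∈ cl η.toFinset a} ω) * hpow + (weight (fun e => (w e : ℝ)) ω * q ^ clusterCount (ω ∩ ↑DX) ({a, h} : Set V) * q ^ clusterCount (ω \ ↑DX) ({a, h} : Set V)) * ht
  · have hk := k_of_not_mem hah ω hG
    have hpow : q ^ clusterCount ω ∅ * q ^ clusterCount (∅ : BondConfig V) ({a, h} : Set V) = q * (q ^ clusterCount (ω ∩ ↑DX) ({a, h} : Set V) * q ^ clusterCount (ω \ ↑DX) ({a, h} : Set V)) := by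
      rw [← pow_add, hk, Nat.add_right_comm, hadd, pow_succ, pow_add]; ring
    have ht := htab q (fun hb => absurd (jh.2 hb) hG) (fun _ => rfl)
    unfold rcWeightW
    linear_combination (weight (fun e => (w e : ℝ)) ω * ind {η : BondConfig V | b ∉ cl η.toFinset a ∧ c ∈ cl η.toFinset a} ω) * hpow + (weight (fun e => (w e : ℝ)) ω * q ^ clusterCount (ω ∩ ↑DX) ({a, h} : Set V) * q ^ clusterCount (ω \ ↑DX) ({a, h} : Set V)) * ht

include hbc hhb hhc in
/-- **Pointwise decomposition, separating cell `S = {b, c ∉ C(a), C(a) meets every b–c path of DX ∪ DY}`**. [this work] -/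
theorem pt_S (ω : BondConfig V) :
    rcWeightW w q ∅ ω * ind {η : BondConfig V | b ∉ cl η.toFinset a ∧ c ∉ cl η.toFinset a ∧ Sep (DX ∪ DY) (cl η.toFinset a) b c} ω * q ^ clusterCount (∅ : BondConfig V) ({a, h} : Set V) =
      weight (fun e => (w e : ℝ)) ω * ((ind {η : BondConfig V | b ∉ cl η.toFinset a ∧ h ∈ cl η.toFinset a} (ω ∩ ↑DX) * q ^ clusterCount (ω ∩ ↑DX) ({a, h} : Set V)) * (ind {η : BondConfig V | c ∉ cl η.toFinset a ∧ h ∈ cl η.toFinset a} (ω \ ↑DX) * q ^ clusterCount (ω \ ↑DX) ({a, h} : Set V)) + (ind {η : BondConfig V | b ∉ cl η.toFinset a ∧ h ∈ cl η.toFinset a} (ω ∩ ↑DX) * q ^ clusterCount (ω ∩ ↑DX) ({a, h} : Set V)) * (ind {η : BondConfig V | c ∉ cl η.toFinset a ∧ h ∉ cl η.toFinset a ∧ h ∉ cl η.toFinset c} (ω \ ↑DX) * q ^ clusterCount (ω \ ↑DX) ({a, h} : Set V)) + (ind {η : BondConfig V | b ∉ cl η.toFinset a ∧ h ∉ cl η.toFinset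 a ∧ h ∉ cl η.toFinset b} (ω ∩ ↑DX) * q ^ clusterCount (ω ∩ ↑DX) ({a, h} : Set V)) * (ind {η : BondConfig V | c ∉ cl η.toFinset a ∧ h ∈ cl η.toFinset a} (ω \ ↑DX) * q ^ clusterCount (ω \ ↑DX) ({a, h} : Set V)) + q * ((ind {η : BondConfig V | b ∉ cl η.toFinset a ∧ h ∉ cl η.toFinset a ∧ Sep DX (cl η.toFinset a) b h} (ω ∩ ↑DX) * q ^ clusterCount (ω ∩ ↑DX) ({a, h} : Set V)) * ((ind {η : BondConfig V | c ∉ cl η.toFinset a ∧ h ∉ cl η.toFinset a ∧ h ∈ cl η.toFinset c} (ω \ ↑DX) * q ^ clusterCount (ω \ ↑DX) ({a, h} : Set V)) + (ind {η : BondConfig V | c ∉ cl η.toFinset a ∧ h ∉ cl η.toFinset a ∧ h ∉ cl η.toFinset c} (ω \ ↑DX) * q ^ clusterCount (ω \ ↑DX) ({a, h} : Set V))) + ((ind {η : BondConfig V | b ∉ cl η.toFinset a ∧ h ∉ cl η.toFinset a ∧ h ∈ cl η.toFinset b} (ω ∩ ↑DX) * q ^ clusterCount (ω ∩ ↑DX)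 ({a, h} : Set V)) + (ind {η : BondConfig V | b ∉ cl η.toFinset a ∧ h ∉ cl η.toFinset a ∧ h ∉ cl η.toFinset b} (ω ∩ ↑DX) * q ^ clusterCount (ω ∩ ↑DX) ({a, h} : Set V))) * (ind {η : BondConfig V | c ∉ cl η.toFinset a ∧ h ∉ cl η.toFinset a ∧ Sep DY (cl η.toFinset a) c h} (ω \ ↑DX) * q ^ clusterCount (ω \ ↑DX) ({a, h} : Set V)) - (ind {η : BondConfig V | b ∉ cl η.toFinset a ∧ h ∉ cl η.toFinset a ∧ Sep DX (cl η.toFinset a) b h} (ω ∩ ↑DX) * q ^ clusterCount (ω ∩ ↑DX) ({a, h} : Set V)) * (ind {η : BondConfig V | c ∉ cl η.toFinset a ∧ h ∉ cl η.toFinset a ∧ Sep DY (cl η.toFinset a) c h} (ω \ ↑DX) * q ^ clusterCount (ω \ ↑DX) ({a, h} : Set V)))) := by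
  by_cases hω : ω ⊆ ↑DX ∪ ↑DY
  swap
  · obtain ⟨e, heω, heD⟩ := Set.not_subset.1 hω
    have h0 := weight_eq_zero_of_mem_not_mem w hw heω heD
    unfold rcWeightW
    rw [h0]; ring
  have jb := glued_b_iff hab hsepD hbY hω
  have jc := glued_c_iff hac hsepD hcX hω
  have jh := glued_h_iff hsepD hω
  have hadd := kT_add hsepD hω
  -- the separation flag of the glued graph
  have hSep : Sep (DX ∪ DY) (cl ω.toFinset a) b c ↔
      (((ω ∩ ↑DX) ∈ {η : BondConfig V | h ∈ cl η.toFinset a} ∨ (ω \ ↑DX) ∈ {η : BondConfig V | h ∈ cl η.toFinset a}) ∨ ((ω ∩ ↑DX) ∈ {η : BondConfig V | Sep DX (cl η.toFinset a) b h} ∨ (ω \ ↑DX) ∈ {η : BondConfig V | Sep DY (cl η.toFinset a) c h})) := by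
    constructor
    · intro hS
      by_cases hG : h ∈ cl ω.toFinset a
      · exact Or.inl (jh.1 hG)
      · have hn : ¬ ((ω ∩ ↑DX) ∈ {η : BondConfig V | h ∈ cl η.toFinset a} ∨ (ω \ ↑DX) ∈ {η : BondConfig V | h ∈ cl η.toFinset a}) := fun hb => hG (jh.2 hb)
        rw [not_or] at hn
        exact Or.inr ((glued_sep_iff hsepD hbY hcX hbc hhb hhc hω hn.1 hn.2).1 hS)
    · rintro (hb | hn)
      · exact sep_two_of_mem hsepD hbY hcX hbc hhb hhc ω (jh.2 hb)
      · by_cases hG : h ∈ cl ω.toFinset a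
        · exact sep_two_of_mem hsepD hbY hcX hbc hhb hhc ω hG
        · have hn' : ¬ ((ω ∩ ↑DX) ∈ {η : BondConfig V | h ∈ cl η.toFinset a} ∨ (ω \ ↑DX) ∈ {η : BondConfig V | h ∈ cl η.toFinset a}) := fun hb => hG (jh.2 hb)
          rw [not_or] at hn'
          exact (glued_sep_iff hsepD hbY hcX hbc hhb hhc hω hn'.1 hn'.2).2 hn
  -- the table identity, with the power `r = q^{[h ∉ C(a)]}`
  have htab : ∀ r : ℝ, (((ω ∩ ↑DX) ∈ {η : BondConfig V | h ∈ cl η.toFinset a} ∨ (ω \ ↑DX) ∈ {η : BondConfig V | h ∈ cl η.toFinset a}) → r = 1) → (¬ ((ω ∩ ↑DX) ∈ {η : BondConfig V | h ∈ cl η.toFinset a} ∨ (ω \ ↑DX) ∈ {η : BondConfig V | h ∈ cl η.toFinset a}) → r = q) →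
      ind {η : BondConfig V | b ∉ cl η.toFinset a ∧ c ∉ cl η.toFinset a ∧ Sep (DX ∪ DY) (cl η.toFinset a) b c} ω * r = (ind {η : BondConfig V | b ∉ cl η.toFinset a ∧ h ∈ cl η.toFinset a} (ω ∩ ↑DX)) * (ind {η : BondConfig V | c ∉ cl η.toFinset a ∧ h ∈ cl η.toFinset a} (ω \ ↑DX)) + (ind {η : BondConfig V | b ∉ cl η.toFinset a ∧ h ∈ cl η.toFinset a} (ω ∩ ↑DX)) * (ind {η : BondConfig V | c ∉ cl η.toFinset a ∧ h ∉ cl η.toFinset a ∧ h ∉ cl η.toFinset c} (ω \ ↑DX)) + (ind {η : BondConfig V | b ∉ cl η.toFinset a ∧ h ∉ cl η.toFinset a ∧ h ∉ cl η.toFinset b} (ω ∩ ↑DX)) * (ind {η : BondConfig V | c ∉ cl η.toFinset a ∧ h ∈ cl η.toFinset a} (ω \ ↑DX)) + q * ((ind {η : BondConfig V | b ∉ cl η.toFinset a ∧ h ∉ cl η.toFinset a ∧ Sep DX (cl η.toFinset a) b h} (ω ∩ ↑DX)) * ((ind {η : BondConfig V | c ∉ cl η.toFinset a ∧ h ∉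 cl η.toFinset a ∧ h ∈ cl η.toFinset c} (ω \ ↑DX)) + (ind {η : BondConfig V | c ∉ cl η.toFinset a ∧ h ∉ cl η.toFinset a ∧ h ∉ cl η.toFinset c} (ω \ ↑DX))) + ((ind {η : BondConfig V | b ∉ cl η.toFinset a ∧ h ∉ cl η.toFinset a ∧ h ∈ cl η.toFinset b} (ω ∩ ↑DX)) + (ind {η : BondConfig V | b ∉ cl η.toFinset a ∧ h ∉ cl η.toFinset a ∧ h ∉ cl η.toFinset b} (ω ∩ ↑DX))) * (ind {η : BondConfig V | c ∉ cl η.toFinset a ∧ h ∉ cl η.toFinset a ∧ Sep DY (cl η.toFinset a) c h} (ω \ ↑DX)) - (ind {η : BondConfig V | b ∉ cl η.toFinset a ∧ h ∉ cl η.toFinset a ∧ Sep DX (cl η.toFinset a) b h} (ω ∩ ↑DX)) * (ind {η : BondConfig V | c ∉ cl η.toFinset a ∧ h ∉ cl η.toFinset a ∧ Sep DY (cl η.toFinset a) c h} (ω \ ↑DX))) := by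
    intro r hr1 hrq
    exact table_S (arm_t1 (a := a) (h := h) (t := b) (ω ∩ ↑DX)) (arm_t2 (a := a) (h := h) (t := b) (ω ∩ ↑DX))
      (arm_t3 (a := a) (h := h) (t := b) (ω ∩ ↑DX)) (arm_t1 (a := a) (h := h) (t := c) (ω \ ↑DX))
      (arm_t2 (a := a) (h := h) (t := c) (ω \ ↑DX)) (arm_t3 (a := a) (h := h) (t := c) (ω \ ↑DX)) hr1 hrq
      (fun hf => ind_of_mem (show ω ∈ {η : BondConfig V | b ∉ cl η.toFinset a ∧ c ∉ cl η.toFinset a ∧ Sep (DX ∪ DY) (cl η.toFinset a) b c} from ⟨fun hb' => hf.1 (jb.1 hb'), fun hc' => hf.2.1 (jc.1 hc'), hSep.2 hf.2.2⟩)) (fun hf => ind_of_not_mem (show ω ∉ {η : BondConfig V | b ∉ cl η.toFinset a ∧ c ∉ cl η.toFinset a ∧ Sep (DX ∪ DY) (cl η.toFinset a) b c} from fun hS => hf ⟨fun hb' => hS.1 (jb.2 hb'), fun hc' => hS.2.1 (jc.2 hc'), hSep.1 hS.2.2⟩))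
      (fun hh => ind_of_mem hh) (fun hh => ind_of_not_mem hh)
      (fun hh => ind_of_mem hh) (fun hh => ind_of_not_mem hh)
      (fun hh => ind_of_mem hh) (fun hh => ind_of_not_mem hh)
      (fun hh => ind_of_mem hh) (fun hh => ind_of_not_mem hh)
      (fun hh => ind_of_mem hh) (fun hh => ind_of_not_mem hh)
      (fun hh => ind_of_mem hh) (fun hh => ind_of_not_mem hh)
      (fun hh => ind_of_mem hh) (fun hh => ind_of_not_mem hh)
      (fun hh => ind_of_mem hh) (fun hh => ind_of_not_mem hh)
  by_cases hG : h ∈ cl ω.toFinset a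
  · have hk := k_of_mem hah ω hG
    have hpow : q ^ clusterCount ω ∅ * q ^ clusterCount (∅ : BondConfig V) ({a, h} : Set V) = q ^ clusterCount (ω ∩ ↑DX) ({a, h} : Set V) * q ^ clusterCount (ω \ ↑DX) ({a, h} : Set V) := by
      rw [← pow_add, hk, hadd, pow_add]
    have ht := htab 1 (fun _ => rfl) (fun hn => absurd (jh.1 hG) hn)
    unfold rcWeightW
    linear_combination (weight (fun e => (w e : ℝ)) ω * ind {η : BondConfig V | b ∉ cl η.toFinset a ∧ c ∉ cl η.toFinset a ∧ Sep (DX ∪ DY) (cl η.toFinset a) b c} ω) * hpow + (weight (fun e => (w e : ℝ)) ω * q ^ clusterCount (ω ∩ ↑DX) ({a, h} : Set V) * q ^ clusterCount (ω \ ↑DX) ({a, h} : Set V)) * ht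
  · have hk := k_of_not_mem hah ω hG
    have hpow : q ^ clusterCount ω ∅ * q ^ clusterCount (∅ : BondConfig V) ({a, h} : Set V) = q * (q ^ clusterCount (ω ∩ ↑DX) ({a, h} : Set V) * q ^ clusterCount (ω \ ↑DX) ({a, h} : Set V)) := by
      rw [← pow_add, hk, Nat.add_right_comm, hadd, pow_succ, pow_add]; ring
    have ht := htab q (fun hb => absurd (jh.2 hb) hG) (fun _ => rfl)
    unfold rcWeightW
    linear_combination (weight (fun e => (w e : ℝ)) ω * ind {η : BondConfig V | b ∉ cl η.toFinset a ∧ c ∉ cl η.toFinset a ∧ Sep (DX ∪ DY) (cl η.toFinset a) b c} ω) * hpow + (weight (fun e => (w e : ℝ)) ω * q ^ clusterCount (ω ∩ ↑DX) ({a, h} : Set V) * q ^ clusterCount (ω \ ↑DX) ({a, h} : Set V)) * ht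

end Pointwise

end ApexTwoSum

end Summit.CriticalPhenomena.PercolationContinuityZ3.Theorems
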